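import Mathlib
import HarnessLib
import Summits.AtomisticToContinuum.Crystallization.Theorems.FrustratedLawDichotomyTwoShellRigidityLsFitReplaySound1

/-!
# Two-shell rigidity, slot 3 · the `SphericalLsFit` replay engine (3): the certified leaf bounds and
# the replay induction   (decomp-a2c, lens 3, gen 37 — NODE «SphericalLsFitReplay»)

Sequel of `…LsFitReplaySound1`.  `LeafBounds m prm Mq n x`: the REAL content of an accepted `fit`
instruction for a configuration `x` in its boxes — the four families of certified inequalities on the
integer fit functionals (`fitObj0`, `fitObjW`, `fitObj2`, `fitObj3`) in the leaf frame `R = Mq/n`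
(`applyFit_sound`).  `runInstrsF_sound` / `runCellF_sound`: a passing fit replay assigns to EVERY
feasible braced configuration of the cell some accepted leaf (`FitVerified`), by strong induction on
the stream exactly as `Rig.runInstrs_sound` (`place` both branches, `split` both half-spaces by
`cut_dichotomy`, `bound`/`prune` by the box-level soundness of part 2).
`[folklore]`; no `sorry`; no `instance`/`notation`; no data.
-/

namespace Summit.AtomisticToContinuum.Crystallization.Theorems

namespace Rig

open Literature.Analysis.ValidatedNumerics.NumericsMP
open scoped Matrix

/-! ### The certified leaf bounds -/

/-- **The real content of an accepted `fit`** in the leaf frame `(Mq, n)` (`R = Mq/n`):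
`n > 0`; (F0) `n·F0L ≤ S·Σ_k (Mq tab i)_k x i k`; (F1) integer bounds `|S·W_k(x)| ≤ B k` with
`Σ B² ≤ n²·OM2`; (F2)/(F3) for every probe `(mv, k)` of the table (`k ∈ {1,2,3}`) and every point /
bonded pair, `S·G(x) − 8 n N·encBelow ⟪mv, ·⟫ ≤ n·V1K k` (resp. `V3K k`). -/
structure LeafBounds (m : Model) (prm : FitPrm) (Mq : Fin 3 → Fin 3 → ℤ) (n : ℤ)
    (x : Fin 12 → Fin 3 → ℝ) : Prop where
  /-- the quaternion is non-zero -/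
  npos : 0 < n
  /-- (F0) -/
  f0 : ∀ i, (n : ℝ) * prm.F0L ≤ (SC : ℝ) * fval (fitObj0 m Mq i) x
  /-- (F1) -/
  f1 : ∃ B : Fin 3 → ℤ, (∀ k, |(SC : ℝ) * fval (fitObjW m Mq k) x| ≤ (B k : ℝ)) ∧
    (∑ k, B k ^ 2) ≤ n ^ 2 * prm.OM2
  /-- (F2) -/
  f2 : ∀ e ∈ prm.ptab, kOK e.2 = true ∧ ∀ i,
    (SC : ℝ) * fval (fitObj2 m Mq e.1 i) x
      - 8 * (n : ℝ) * m.normSq * (encBelow m.normSq (dotZ e.1 (m.tab i)) : ℝ) ≤ (n : ℝ) * prm.V1K.getK e.2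
  /-- (F3) -/
  f3 : ∀ e ∈ prm.ptab, kOK e.2 = true ∧ ∀ q ∈ bondPairs m,
    (SC : ℝ) * fval (fitObj3 m Mq e.1 q.1 q.2) x
      - 8 * (n : ℝ) * m.normSq * (encBelow m.normSq (dotZ e.1 (fun k => m.tab q.1 k - m.tab q.2 k)) : ℝ)
        ≤ (n : ℝ) * prm.V3K.getK e.2

/-- Some leaf of the replay accepted the configuration. -/
def FitVerified (m : Model) (prm : FitPrm) (x : Fin 12 → Fin 3 → ℝ) : Prop :=
  ∃ (qw qx qy qz : ℤ) (refl : Bool), LeafBounds m prm (quatMat qw qx qy qz refl) (quatNorm qw qx qy qz) x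

/-- `getD` at a valid index is the element. -/
theorem getD_eq_of_lt {α : Type*} (l : List α) (d : α) {j : ℕ} (hj : j < l.length) :
    l.getD j d = l[j] := by
  rw [List.getD_eq_getElem?_getD, List.getElem?_eq_getElem hj, Option.getD_some]

/-- **Soundness of `applyFit`.** -/
theorem applyFit_sound {m : Model} {prm : FitPrm} {x : Fin 12 → Fin 3 → ℝ} (hF : Feasible m.bond x)
    (hB : BraceHolds m prm.B2 x) {bx : Boxes} (hx : bx.mem x) {cuts : List Cut} (hcuts : CutsHold cuts x)
    {st : List Step} {qw qx qy qz : ℤ} {refl : Bool} {certs : List Cert}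
    (h : applyFit m prm bx st cuts qw qx qy qz refl certs = true) :
    LeafBounds m prm (quatMat qw qx qy qz refl) (quatNorm qw qx qy qz) x := by
  unfold applyFit at h
  by_cases hg : (st.isEmpty && (List.finRange 12).all (fun v => bx.placed v) &&
      decide (0 < quatNorm qw qx qy qz)) = true
  · rw [if_pos hg] at h
    simp only [Bool.and_eq_true, decide_eq_true_eq] at hg h
    obtain ⟨⟨-, hallb⟩, hn⟩ := hg
    obtain ⟨⟨⟨h0, h1⟩, h2⟩, h3⟩ := h
    have hall : AllPlaced bx := allPlaced_of_all hallb
    have hrows := rowsF_hold_arr hF hB hx hcuts (fun _ => hall)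
    refine ⟨hn, ?_, ?_, ?_, ?_⟩
    · intro i
      unfold fitTest0 at h0
      rw [List.all_eq_true] at h0
      have hi := h0 i (List.mem_finRange i)
      rw [decide_eq_true_eq] at hi
      have hv := valLower_sound hrows hx hall (fitObj0 m (quatMat qw qx qy qz refl) i) (certAt certs (fitIdx0 i))
      have hc : ((quatNorm qw qx qy qz * prm.F0L : ℤ) : ℝ) ≤
          (valLower bx (rowsOfF m prm bx cuts).toArray (fitObj0 m (quatMat qw qx qy qz refl) i)
            (certAt certs (fitIdx0 i)) : ℝ) := by exact_mod_cast hi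
      push_cast at hc
      linarith
    · refine ⟨fitAbsW m bx (rowsOfF m prm bx cuts).toArray (quatMat qw qx qy qz refl) certs, fun k => ?_, ?_⟩
      · have hu := valUpper_sound hrows hx hall (fitObjW m (quatMat qw qx qy qz refl) k)
          (certAt certs (fitIdx1 k true))
        have hl := valLower_sound hrows hx hall (fitObjW m (quatMat qw qx qy qz refl) k)
          (certAt certs (fitIdx1 k false))
        unfold fitAbsW
        push_cast
        rw [abs_le]
        constructor
        · have := le_max_right
            (valUpper bx (rowsOfF m prm bx cuts).toArray (fitObjW m (quatMat qw qx qy qz refl) k)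
              (certAt certs (fitIdx1 k true)) : ℝ)
            (-(valLower bx (rowsOfF m prm bx cuts).toArray (fitObjW m (quatMat qw qx qy qz refl) k)
              (certAt certs (fitIdx1 k false)) : ℝ))
          linarith
        · exact hu.trans (le_max_left _ _)
      · unfold fitTest1 at h1
        rw [decide_eq_true_eq] at h1
        exact h1
    · intro e he
      obtain ⟨j, hj, hje⟩ := List.getElem_of_mem he
      unfold fitTest2 at h2
      rw [List.all_eq_true] at h2
      have hj' := h2 j (List.mem_range.2 hj)
      have hgetD : prm.ptab.getD j (0, 0) = e := by rw [getD_eq_of_lt _ _ hj, hje]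
      simp only [hgetD, Bool.and_eq_true, List.all_eq_true, decide_eq_true_eq] at hj'
      obtain ⟨hk, hi⟩ := hj'
      refine ⟨hk, fun i => ?_⟩
      have hii := hi i (List.mem_finRange i)
      have hu := valUpper_sound hrows hx hall (fitObj2 m (quatMat qw qx qy qz refl) e.1 i)
        (certAt certs (fitIdx2 j i))
      have hc : ((valUpper bx (rowsOfF m prm bx cuts).toArray (fitObj2 m (quatMat qw qx qy qz refl) e.1 i)
            (certAt certs (fitIdx2 j i)) -
          8 * quatNorm qw qx qy qz * (m.normSq : ℤ) * encBelow m.normSq (dotZ e.1 (m.tab i)) : ℤ) : ℝ) ≤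
          ((quatNorm qw qx qy qz * prm.V1K.getK e.2 : ℤ) : ℝ) := by exact_mod_cast hii
      push_cast at hc
      linarith
    · intro e he
      obtain ⟨j, hj, hje⟩ := List.getElem_of_mem he
      unfold fitTest3 at h3
      rw [List.all_eq_true] at h3
      have hj' := h3 j (List.mem_range.2 hj)
      have hgetD : prm.ptab.getD j (0, 0) = e := by rw [getD_eq_of_lt _ _ hj, hje]
      simp only [hgetD, Bool.and_eq_true, List.all_eq_true, decide_eq_true_eq] at hj'
      obtain ⟨hk, ht⟩ := hj'
      refine ⟨hk, fun q hq => ?_⟩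
      obtain ⟨t, htl, htq⟩ := List.getElem_of_mem hq
      have htt := ht t (List.mem_range.2 htl)
      have hgetq : (bondPairs m).getD t (0, 0) = q := by rw [getD_eq_of_lt _ _ htl, htq]
      simp only [hgetq] at htt
      have hu := valUpper_sound hrows hx hall (fitObj3 m (quatMat qw qx qy qz refl) e.1 q.1 q.2)
        (certAt certs (fitIdx3 prm.ptab.length (bondPairs m).length j t))
      have hc : ((valUpper bx (rowsOfF m prm bx cuts).toArray
            (fitObj3 m (quatMat qw qx qy qz refl) e.1 q.1 q.2)
            (certAt certs (fitIdx3 prm.ptab.length (bondPairs m).length j t)) -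
          8 * quatNorm qw qx qy qz * (m.normSq : ℤ) *
            encBelow m.normSq (dotZ e.1 (fun k => m.tab q.1 k - m.tab q.2 k)) : ℤ) : ℝ) ≤
          ((quatNorm qw qx qy qz * prm.V3K.getK e.2 : ℤ) : ℝ) := by exact_mod_cast htt
      push_cast at hc
      linarith
  · rw [if_neg hg] at h
    exact absurd h (by simp)

/-! ### Replay induction -/

/-- **Soundness of the fit replay**: if `runInstrsF` accepts, every feasible braced configuration in
the boxes satisfying the cuts is accepted by some leaf. -/
theorem runInstrsF_sound {m : Model} (hW : m.WF) {prm : FitPrm} {x : Fin 12 → Fin 3 → ℝ}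
    (hF : Feasible m.bond x) (hB : BraceHolds m prm.B2 x) :
    ∀ (n : ℕ) (is : List InstrF), is.length ≤ n → ∀ (bx : Boxes) (st : List Step) (cuts : List Cut),
      bx.mem x → StepsOK m st → CutsHold cuts x → (cuts ≠ [] → AllPlaced bx) →
      runInstrsF m prm bx st cuts is = true → FitVerified m prm x := by
  intro n
  induction n with
  | zero =>
    intro is hlen bx st cuts _ _ _ _ h
    have : is = [] := List.eq_nil_of_length_eq_zero (Nat.le_zero.1 hlen)
    subst this; simp [runInstrsF] at h
  | succ n ih =>
    intro is hlen bx st cuts hx hst hcuts hall h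
    cases is with
    | nil => simp [runInstrsF] at h
    | cons i is =>
      have hlen' : is.length ≤ n := by simp at hlen; omega
      cases i with
      | place terms k =>
        rw [runInstrsF] at h
        revert h
        cases hpb : placeBoxes bx st with
        | none => simp
        | some r =>
          obtain ⟨v, main, alt, rest⟩ := r
          intro h
          simp only [Bool.and_eq_true] at h
          obtain ⟨halt, hmain⟩ := h
          obtain ⟨hcases, hrest⟩ := placeBoxes_sound hW hF hx hst hpb
          rcases hcases with hm | ha
          · exact ih (is.drop k) (le_trans (by rw [List.length_drop]; omega) hlen') _ rest cuts
              (mem_update hx v hm) hrest hcuts (fun hne w => placed_update v main (hall hne w)) hmain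
          · have hxAlt := mem_update hx v ha
            have hallAlt : cuts ≠ [] → AllPlaced (Function.update bx v (some alt)) :=
              fun hne w => placed_update v alt (hall hne w)
            by_cases hci : certInfeasible (Function.update bx v (some alt))
                (rowsOfF m prm (Function.update bx v (some alt)) cuts).toArray terms = true
            · exact absurd (pruneF_sound hF hB hxAlt hcuts hallAlt terms) (by rw [hci]; simp)
            · rw [if_neg hci] at halt
              exact ih (is.take k) (le_trans (by rw [List.length_take]; omega) hlen') _ rest cuts hxAlt
                hrest hcuts hallAlt halt
      | split a ub k =>
        rw [runInstrsF] at h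
        by_cases hpl : (List.finRange 12).all (fun v => bx.placed v) = true
        · rw [if_pos hpl] at h
          simp only [Bool.and_eq_true] at h
          obtain ⟨h1, h2⟩ := h
          have hallbx : AllPlaced bx := allPlaced_of_all hpl
          rcases cut_dichotomy ⟨denseCoeff a, ub⟩ x with hc | hc
          · refine ih (is.take k) (le_trans (by rw [List.length_take]; omega) hlen') bx st _ hx hst
              ?_ (fun _ => hallbx) h1
            intro c' hc'
            rcases List.mem_cons.1 hc' with rfl | h'
            · exact hc
            · exact hcuts c' h'
          · refine ih (is.drop k) (le_trans (by rw [List.length_drop]; omega) hlen') bx st _ hx hst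
              ?_ (fun _ => hallbx) h2
            intro c' hc'
            rcases List.mem_cons.1 hc' with rfl | h'
            · exact hc
            · exact hcuts c' h'
        · rw [if_neg hpl] at h
          exact absurd h (by simp)
      | bound v k up cert =>
        simp only [runInstrsF] at h
        obtain ⟨hnp, hrun⟩ := applyBoundF_sound hF hB hx hcuts hall st v k up cert
        have hnv := applyBoundF_ne_verified m prm bx st cuts v k up cert
        revert h
        cases hab : applyBoundF m prm bx st cuts v k up cert with
        | pruned => exact absurd hab hnp
        | verified => exact absurd hab hnv
        | failed => simp
        | running bx' st' =>
          intro h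
          obtain ⟨hx', hst', hpl'⟩ := hrun bx' st' hab
          exact ih is hlen' bx' st' cuts hx' (by rw [hst']; exact hst) hcuts
            (fun hne w => hpl' w (hall hne w)) h
      | prune terms =>
        rw [runInstrsF, pruneF_sound hF hB hx hcuts hall terms] at h
        exact absurd h (by simp)
      | fit qw qx qy qz refl certs =>
        rw [runInstrsF] at h
        exact ⟨qw, qx, qy, qz, refl, applyFit_sound hF hB hx hcuts h⟩

/-- **Soundness of the fit cell checker**: every feasible braced configuration in the cell (normal
form `InCell`) is accepted by some leaf. -/
theorem runCellF_sound {m : Model} (hW : m.WF) {prm : FitPrm} {c : CellF}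
    (h : runCellF m prm c = true) {x : Fin 12 → Fin 3 → ℝ} (hF : Feasible m.bond x)
    (hB : BraceHolds m prm.B2 x) (hc : InCell m c.skel x) : FitVerified m prm x := by
  obtain ⟨hnn, hmem⟩ := initBoxes_sound hW hF hc
  unfold runCellF at h
  revert h
  cases hib : initBoxes m c.skel with
  | none => simp
  | some ob =>
    cases ob with
    | none => exact absurd hib hnn
    | some bx =>
      intro h
      exact runInstrsF_sound hW hF hB c.instrs.length c.instrs le_rfl bx m.steps [] (hmem bx hib)
        (stepsOK_of_WF hW) (fun c hc => absurd hc (by simp)) (fun hne => absurd rfl hne) h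

end Rig

end Summit.AtomisticToContinuum.Crystallization.Theorems
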